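import Summits.QuantumFields.YangMills.Theorems.FlatTubeReductionBOProjectionAdapted
import Summits.QuantumFields.YangMills.Theorems.LuscherReductionTwistedTraceScalingBTCoreWeight
import Summits.QuantumFields.YangMills.Theorems.LuscherReductionTwistedTraceScalingBTFixedBeta
import Summits.QuantumFields.YangMills.Theorems.LuscherReductionTwistedTraceScalingBODefect
import HarnessLib

/-!
# THE (B-ST) TRANSFER: an `hST`-shaped stiff-gap bound for fibre-orthogonality to the UN-normalised profile `Ω₀` (lane A's shape) gives the `hST` field of `RateTube.AnalyticRatePotInput`
# for the NORMALISED profile `Ω β u x = n(u)·Ω₀(x)` — provided the normaliser vanishes only on fibres of zero mass; plus the normalisation inequality `btC ≤ f(1)`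
# (route `FlatTubeReduction`, crux K1 `NearFlatRatioLaw` stmt-QuantumFields-24720; seat `ym-line-ftr-p1` g17; rate twin «ratepack-v5»; R2b1 RECORD rung — no summit statement is proved here)

WHY (NOTES `## ST-PORT`).  The rate twin's `hST` (`…RecordWindowSixth.AnalyticRatePotInput.hST`) quantifies over `v` that are fibre-orthogonal to `Ω β = n_β·Ω₀_β` in the sense
`fibreInnerAd (softWeight χ) (Ω β) v u = 0` for every slow datum `u`; lane A's (B-ST) pen (`…BORecordInputOfST.recordAnalyticInput_of_hST`, assembly `…BOStiffAssembly.hST_of_pieces`)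
delivers the bound for `v` with `fibreInner (softWeight χ) Ω₀ v u = 0`.  Since `fibreInnerAd w (n·Ω₀) v u = n(u)·fibreInner w Ω₀ v u`, the two agree at every `u` with `n(u) ≠ 0`;
at a `u` with `n(u) = 0` nothing transfers — unless such fibres carry no mass (`fibreMass w Ω₀ u = 0`), where `fibreInner w Ω₀ v u = 0` automatically.  This is exactly the positivity
conjunct exported by `…ProfileDressingPackageR.profileDressing_package_Rpos`.  The normalisation constants compare one way: `btC = fpBOKernel(Ω, coreWeight ε R₁)(1,1)/K(1,1) ≤
fpBOKernel(Ω, fpWeight ε)(1,1)/K(1,1)` (the tail weight is nonnegative), which is the direction the port needs (`Λ_A ≤ σ_rate·λ₀·(1+o(1))`).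
* §1 `fibreInnerAd_normalised` (`= n u·fibreInner`), `fibreMass_nonneg'`, ★ `fibreInner_eq_zero_of_fibreMass_eq_zero`, ★★ `fibreInner_eq_zero_of_fibreInnerAd` (the orthogonality transfer);
* §2 ★ `btC_le_diag` (`btC β Ω ε R₁ ≤ fpBOKernel(Ω, fpWeight ε)(1,1)/K(1,1)` for `Ω ≥ 0`);
* §3 ★★★ `hST_transfer` — from `∀ v … (∀ u, fibreInner w Ω₀ v u = 0) → tubeForm β v ≤ (1−θ)·Λ·T(v)` and `(1−θ)Λ ≤ (1−θ')Λ'` to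
  `∀ v … (∀ u, fibreInnerAd w (fun u x => n u·Ω₀ x) v u = 0) → tubeForm β v ≤ (1−θ')·Λ'·T(v)` (`w = softWeight χ ≥ 0`, bounded measurable data); ★★ `hST_transfer_eventually`.
HONEST FRAMING: bookkeeping for the (B-ST) port; lane A's (B-ST) itself is OPEN (their pen), and the hODpot-rate analysis remains; femto rung R2b1 (RECORD label); not infinite volume,
not a gap, not Clay.  No defs, no named facts, no `sorry`.
-/

set_option autoImplicit false

noncomputable section

open MeasureTheory Filter Topology Real
open scoped BigOperators
open Literature.MathematicalPhysics.QuantumFieldTheory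
open Literature.MathematicalPhysics.QuantumLattice

namespace Summit.QuantumFields.YangMills.Theorems.FemtoTransferGap.RateTube

open Summit.QuantumFields.YangMills.Theorems.FemtoTransferGap
open Summit.QuantumFields.YangMills.Theorems.FemtoTransferGap.TwoLattice
open Summit.QuantumFields.YangMills.Theorems.FemtoTransferGap.TwoLattice.ConstTube
open Summit.QuantumFields.YangMills.Theorems.FemtoTransferGap.TwoLattice.Avg
open Summit.QuantumFields.YangMills.Theorems.FemtoTransferGap.TwoLattice.Stiff (LinkSpace)

variable {L : ℕ} [NeZero L]

/-! ## §1 The orthogonality transfer -/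

/-- The fibre pairing of a normalised profile: `fibreInnerAd w (u ↦ n u·Ω₀) v u = n u · fibreInner w Ω₀ v u`. [folklore] -/
theorem fibreInnerAd_normalised (w : GaugeConfig 3 L SU2 → ℝ) (n : GaugeConfig 3 1 SU2 → ℝ) (Ω₀ : LinkSpace L → ℝ) (v : GaugeConfig 3 L SU2 → ℝ) (u : GaugeConfig 3 1 SU2) :
    fibreInnerAd L w (fun u x => n u * Ω₀ x) v u = n u * fibreInner L w Ω₀ v u := by
  unfold fibreInnerAd fibreInner
  rw [← integral_const_mul]
  refine integral_congr_ae (ae_of_all _ fun x => ?_)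
  simp only
  ring

/-- The fibre mass is nonnegative for a nonnegative weight. [folklore] -/
theorem fibreMass_nonneg' {w : GaugeConfig 3 L SU2 → ℝ} (hw0 : ∀ U, 0 ≤ w U) (Ω₀ : LinkSpace L → ℝ) (u : GaugeConfig 3 1 SU2) : 0 ≤ fibreMass L w Ω₀ u := by
  unfold fibreMass
  exact integral_nonneg fun x => mul_nonneg (sq_nonneg _) (hw0 _)

/-- ★ **Fibres of zero mass carry no pairing**: if `∫ Ω₀² w(orthoTube u ·) dπ = 0` (`w ≥ 0`, bounded measurable data) then `fibreInner w Ω₀ v u = 0` for every `v`.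
[folklore] -/
theorem fibreInner_eq_zero_of_fibreMass_eq_zero {w : GaugeConfig 3 L SU2 → ℝ} (hwm : Measurable w) {Cw : ℝ} (hCw : ∀ U, |w U| ≤ Cw) (hw0 : ∀ U, 0 ≤ w U)
    {Ω₀ : LinkSpace L → ℝ} (hΩm : Measurable Ω₀) {CΩ : ℝ} (hCΩ : ∀ x, |Ω₀ x| ≤ CΩ) (v : GaugeConfig 3 L SU2 → ℝ)
    {u : GaugeConfig 3 1 SU2} (hmass : fibreMass L w Ω₀ u = 0) : fibreInner L w Ω₀ v u = 0 := by
  haveI := isFiniteMeasure_orthoTransverse L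
  have hCΩ0 : 0 ≤ CΩ := (abs_nonneg _).trans (hCΩ 0)
  -- the mass integrand is integrable, nonnegative, with integral zero: it vanishes a.e.
  have hint : Integrable (fun x : Edge 3 L → Fin 3 → ℝ => Ω₀ (linkEmbed L x) ^ 2 * w (orthoTube L u x)) (orthoTransverse L) :=
    integrable_of_measurable_abs_le _ (((hΩm.comp (measurable_linkEmbed L)).pow_const 2).mul (hwm.comp (measurable_orthoTube_right u))) (C := CΩ ^ 2 * Cw) fun x => by
      rw [abs_mul, abs_pow]
      exact mul_le_mul (pow_le_pow_left₀ (abs_nonneg _) (hCΩ _) 2) (hCw _) (abs_nonneg _) (by positivity)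
  have hae : (fun x : Edge 3 L → Fin 3 → ℝ => Ω₀ (linkEmbed L x) ^ 2 * w (orthoTube L u x)) =ᵐ[orthoTransverse L] 0 := by
    have h := (integral_eq_zero_iff_of_nonneg_ae (ae_of_all _ fun x => mul_nonneg (sq_nonneg _) (hw0 _)) hint).1 (by unfold fibreMass at hmass; exact hmass)
    exact h
  unfold fibreInner
  refine integral_eq_zero_of_ae (hae.mono fun x hx => ?_)
  have hx' : Ω₀ (linkEmbed L x) ^ 2 * w (orthoTube L u x) = 0 := hx
  rcases mul_eq_zero.1 hx' with h | h
  · rw [pow_eq_zero_iff two_ne_zero] at h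
    simp only [h, mul_zero, zero_mul, Pi.zero_apply]
  · simp only [h, mul_zero, Pi.zero_apply]

/-- ★★ **THE ORTHOGONALITY TRANSFER**: if the normaliser is positive on fibres of positive mass (`0 < fibreMass w Ω₀ u → 0 < n u`), then
`fibreInnerAd w (u ↦ n u·Ω₀) v u = 0 → fibreInner w Ω₀ v u = 0` for every `v` and every `u`. [folklore] -/
theorem fibreInner_eq_zero_of_fibreInnerAd {w : GaugeConfig 3 L SU2 → ℝ} (hwm : Measurable w) {Cw : ℝ} (hCw : ∀ U, |w U| ≤ Cw) (hw0 : ∀ U, 0 ≤ w U)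
    {Ω₀ : LinkSpace L → ℝ} (hΩm : Measurable Ω₀) {CΩ : ℝ} (hCΩ : ∀ x, |Ω₀ x| ≤ CΩ) {n : GaugeConfig 3 1 SU2 → ℝ} (hn : ∀ u, 0 < fibreMass L w Ω₀ u → 0 < n u)
    (v : GaugeConfig 3 L SU2 → ℝ) {u : GaugeConfig 3 1 SU2} (horth : fibreInnerAd L w (fun u x => n u * Ω₀ x) v u = 0) :
    fibreInner L w Ω₀ v u = 0 := by
  rcases (fibreMass_nonneg' hw0 Ω₀ u).eq_or_lt with h0 | hpos
  · exact fibreInner_eq_zero_of_fibreMass_eq_zero hwm hCw hw0 hΩm hCΩ v h0.symm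
  · rw [fibreInnerAd_normalised] at horth
    rcases mul_eq_zero.1 horth with h | h
    · exact absurd h (hn u hpos).ne'
    · exact h

/-! ## §2 The normalisation inequality -/

/-- ★ **`btC ≤ f(1)`**: the (B-T) constant with the CORE weight is at most the diagonal ratio with the full Faddeev–Popov weight,
`btC β Ω ε R₁ ≤ fpBOKernel(Ω, fpWeight ε)(1,1)/K_{L³β}(1,1)` (`Ω ≥ 0` bounded measurable; the tail part of the kernel is nonnegative). [folklore] -/
theorem btC_le_diag (β : ℝ) {Ω : LinkSpace L → ℝ} (hΩm : Measurable Ω) {CΩ : ℝ} (hCΩ : ∀ x, |Ω x| ≤ CΩ) (hΩ0 : ∀ x, 0 ≤ Ω x) (ε R₁ : ℝ) :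
    btC L β Ω ε R₁ ≤ fpBOKernel L β Ω (fpWeight L ε) 1 1 / transferKernel su2Rep ((L : ℝ) ^ 3 * β) (1 : GaugeConfig 3 1 SU2) 1 := by
  unfold btC
  refine div_le_div_of_nonneg_right ?_ (transferKernel_pos _ _ _ _).le
  rw [fpBOKernel_fpWeight_split β ε R₁ hΩm hCΩ]
  have htail := fpBOKernel_nonneg β hΩm hCΩ hΩ0 (measurable_tailWeight ε R₁) (abs_tailWeight_le ε R₁) (fun g => (tailWeight_mem_Icc ε R₁ g).1) (1 : GaugeConfig 3 1 SU2) 1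
  linarith

/-! ## §3 The `hST` transfer -/

/-- ★★★ **THE (B-ST) TRANSFER, fixed `β`.**  Weight `w ≥ 0` (bounded measurable), profile `Ω₀` (bounded measurable), normaliser `n` positive on fibres of positive mass, and constants with
`(1 − θ)·Λ ≤ (1 − θ')·Λ'`.  If every bounded measurable `v` supported in `{χ ≠ 0}` and fibre-orthogonal to `Ω₀` (`fibreInner w Ω₀ v u = 0` for all `u`) satisfies
`tubeForm β v ≤ (1 − θ)·Λ·tubeNormSq w v`, then every such `v` fibre-orthogonal to the normalised profile (`fibreInnerAd w (u ↦ n u·Ω₀) v u = 0` for all `u`) satisfies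
`tubeForm β v ≤ (1 − θ')·Λ'·tubeNormSq w v`. [cite: Luscher1983, §3] -/
theorem hST_transfer {β : ℝ} {χ w : GaugeConfig 3 L SU2 → ℝ} (hwm : Measurable w) {Cw : ℝ} (hCw : ∀ U, |w U| ≤ Cw) (hw0 : ∀ U, 0 ≤ w U)
    {Ω₀ : LinkSpace L → ℝ} (hΩm : Measurable Ω₀) {CΩ : ℝ} (hCΩ : ∀ x, |Ω₀ x| ≤ CΩ) {n : GaugeConfig 3 1 SU2 → ℝ} (hn : ∀ u, 0 < fibreMass L w Ω₀ u → 0 < n u)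
    {θ Λ θ' Λ' : ℝ} (hcmp : (1 - θ) * Λ ≤ (1 - θ') * Λ')
    (hST : ∀ v : GaugeConfig 3 L SU2 → ℝ, Measurable v → (∃ C : ℝ, ∀ U, |v U| ≤ C) → (∀ U, v U ≠ 0 → χ U ≠ 0) → (∀ u, fibreInner L w Ω₀ v u = 0) →
      tubeForm β v ≤ (1 - θ) * Λ * tubeNormSq w v) :
    ∀ v : GaugeConfig 3 L SU2 → ℝ, Measurable v → (∃ C : ℝ, ∀ U, |v U| ≤ C) → (∀ U, v U ≠ 0 → χ U ≠ 0) → (∀ u, fibreInnerAd L w (fun u x => n u * Ω₀ x) v u = 0) →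
      tubeForm β v ≤ (1 - θ') * Λ' * tubeNormSq w v := by
  intro v hvm hvb hvs horth
  have h := hST v hvm hvb hvs fun u => fibreInner_eq_zero_of_fibreInnerAd hwm hCw hw0 hΩm hCΩ hn v (horth u)
  exact h.trans (mul_le_mul_of_nonneg_right hcmp (tubeNormSq_nonneg' hw0 v))

/-- ★★ **THE (B-ST) TRANSFER, eventually in `β`** (families `χ_β, Ω₀_β, n_β, θ, Λ_β, θ', Λ'_β`; the comparison `(1−θ)Λ_β ≤ (1−θ')Λ'_β` eventually). [cite: Luscher1983, §3] -/
theorem hST_transfer_eventually {χ : ℝ → GaugeConfig 3 L SU2 → ℝ} (hwm : ∀ β, Measurable (softWeight (χ β))) {Cw : ℝ → ℝ} (hCw : ∀ β U, |softWeight (χ β) U| ≤ Cw β)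
    (hw0 : ∀ β U, 0 ≤ softWeight (χ β) U) {Ω₀ : ℝ → LinkSpace L → ℝ} (hΩm : ∀ β, Measurable (Ω₀ β)) {CΩ : ℝ → ℝ} (hCΩ : ∀ β x, |Ω₀ β x| ≤ CΩ β)
    {n : ℝ → GaugeConfig 3 1 SU2 → ℝ} (hn : ∀ β u, 0 < fibreMass L (softWeight (χ β)) (Ω₀ β) u → 0 < n β u)
    {θ θ' : ℝ} {Λ Λ' : ℝ → ℝ} (hcmp : ∀ᶠ β : ℝ in atTop, (1 - θ) * Λ β ≤ (1 - θ') * Λ' β)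
    (hST : ∀ᶠ β : ℝ in atTop, ∀ v : GaugeConfig 3 L SU2 → ℝ, Measurable v → (∃ C : ℝ, ∀ U, |v U| ≤ C) → (∀ U, v U ≠ 0 → χ β U ≠ 0) →
      (∀ u, fibreInner L (softWeight (χ β)) (Ω₀ β) v u = 0) → tubeForm β v ≤ (1 - θ) * Λ β * tubeNormSq (softWeight (χ β)) v) :
    ∀ᶠ β : ℝ in atTop, ∀ v : GaugeConfig 3 L SU2 → ℝ, Measurable v → (∃ C : ℝ, ∀ U, |v U| ≤ C) → (∀ U, v U ≠ 0 → χ β U ≠ 0) →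
      (∀ u, fibreInnerAd L (softWeight (χ β)) (fun u x => n β u * Ω₀ β x) v u = 0) → tubeForm β v ≤ (1 - θ') * Λ' β * tubeNormSq (softWeight (χ β)) v := by
  filter_upwards [hcmp, hST] with β hc h
  exact hST_transfer (hwm β) (hCw β) (hw0 β) (hΩm β) (hCΩ β) (hn β) hc h

end Summit.QuantumFields.YangMills.Theorems.FemtoTransferGap.RateTube

end
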